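import Summits.NavierStokesRegularity.NavierStokesRegularity.Theses.QuantisedSymmetry
import Summits.NavierStokesRegularity.NavierStokesRegularity.Theses.DssFarFieldSlaving
import Summits.NavierStokesRegularity.NavierStokesRegularity.Theorems.QuantisedSymmetryPolyhedralDssProfileExistsDominatesBlowupProfile
import Summits.NavierStokesRegularity.NavierStokesRegularity.Theorems.DssFarFieldSlavingDssTruncationBridge

/-!
# Strategist sketch s18-g4 (independent census, family `s`) — crux `PolyhedralDssProfileExists`
(stmt-NavierStokesRegularity-1404, route QuantisedSymmetry, NEGATIVE side).

Typed record behind `STRATEGY-CENSUS-s18.md` (gen 4). Nothing here is a route item; nothing is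
registered as a line. Sections:

* `crux_gives_W1`, `W1_decides`, `crux_decides` — KERNEL-CHECKED: the crux implies the strictly weaker
  open statement W1 = stmt-0155 (`BlowupTypeIDssProfile`, drop the polyhedral group), and W1 ALONE already
  decides the sub-problem negatively through LANDED theorems (`dssTruncationBridge_proof` +
  `DssFarFieldSlaving.closes`). Hence every statement between the crux and `¬ NavierStokesRegularity`
  is summit-deciding, and the only strictly-weaker intermediate that still reaches the summit is another
  route's deciding crux (0155), not a step for this one.
* `WeakBlowupPiece` (D0, typed) — the "weaker existence" half of an existence/upgrade split; it is the
  conclusion type of `PolyhedralTruncationBridge` plus a Type-I rate and G-equivariance, i.e. X5a-with-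
  symmetry: summit-deciding on its own (fails the "no piece gives S alone" rule).
* `RadiiPolynomialNK` (D2a, typed, provable: Banach) and `CertificateShape` (D2c, typed) — the CAP split;
  D2c is where all content sits (a non-degenerate numerical witness), see the census.
* `StrengthenedWitness` (S⁺, typed) — the crux with the period window / constant floor made explicit;
  by the landed stubs N1/N2 it is equivalent to the crux, so the added rigidity buys nothing.
-/

set_option linter.dupNamespace false

namespace Summit.NavierStokesRegularity.NavierStokesRegularity.Cruxes.PolyhedralDssProfileExists.StrategistS18g4

open MeasureTheory
open Literature.Analysis.FluidPDE
open _root_.Summit.NavierStokesRegularity.NavierStokesRegularity.Theses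

/-- W1 (stmt-0155, deciding crux of route DssFarFieldSlaving) is implied by the crux: landed stub
`stub_dominatesBlowupProfile` (lead c15), restated against the DssFarFieldSlaving copy of the decl
(same definiens). -/
theorem crux_gives_W1 (hX : QuantisedSymmetry.PolyhedralDssProfileExists) :
    DssFarFieldSlaving.BlowupTypeIDssProfile :=
  _root_.Summit.NavierStokesRegularity.NavierStokesRegularity.Theorems.PolyhedralDssProfileExists.PolyhedralCell.stub_dominatesBlowupProfile hX

/-- W1 alone decides the sub-problem (negatively): composition of two LANDED theorems. -/
theorem W1_decides (hW : DssFarFieldSlaving.BlowupTypeIDssProfile) : ¬ _root_.NavierStokesRegularity :=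
  DssFarFieldSlaving.closes
    _root_.Summit.NavierStokesRegularity.NavierStokesRegularity.Theorems.dssTruncationBridge_proof hW

/-- The crux is summit-strength on the negative side: `X⁻ → ¬ S` with no open hypothesis left. -/
theorem crux_decides (hX : QuantisedSymmetry.PolyhedralDssProfileExists) : ¬ _root_.NavierStokesRegularity :=
  W1_decides (crux_gives_W1 hX)

/-- D0 · the "weaker existence" piece of an existence/upgrade split: a G-equivariant Leray–Hopf classical
solution from a rapidly decaying datum with finite maximal lifespan `T` and Type-I rate. It contains the
conclusion of `PolyhedralTruncationBridge` (X5a), hence decides `¬S` by itself (Blowup/ClayUniqueness,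
all landed) — NOT an admissible piece. -/
def WeakBlowupPiece : Prop :=
  ∃ G : Subgroup (EuclideanSpace ℝ (Fin 3) ≃ₗᵢ[ℝ] EuclideanSpace ℝ (Fin 3)), Finite G ∧
    (∀ V : Submodule ℝ (EuclideanSpace ℝ (Fin 3)), (∀ g ∈ G, ∀ v ∈ V, g v ∈ V) → V = ⊥ ∨ V = ⊤) ∧
    ∃ ν : ℝ, 0 < ν ∧ ∃ T : ℝ, 0 < T ∧
      ∃ (v : ℝ → EuclideanSpace ℝ (Fin 3) → EuclideanSpace ℝ (Fin 3)) (p : ℝ → EuclideanSpace ℝ (Fin 3) → ℝ),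
        IsMaximalSmoothSolution ν 0 v p T ∧ IsLerayHopfOn T ν 0 (v 0) v ∧ HasRapidSpatialDecay (v 0) ∧
        (∃ C : ℝ, ∀ t ∈ Set.Ico 0 T, ∀ x, ‖v t x‖ ≤ C / Real.sqrt (T - t)) ∧
        (∀ g ∈ G, ∀ t x, v t (g x) = g (v t x))

/-- D2a · abstract radii-polynomial / Newton–Kantorovich step (provable from Banach's fixed point theorem;
informationless for the crux). -/
def RadiiPolynomialNK : Prop :=
  ∀ (E : Type) [NormedAddCommGroup E] [NormedSpace ℝ E] [CompleteSpace E]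
    (T : E → E) (xbar : E) (r Y Z : ℝ), 0 ≤ r → 0 ≤ Z → Z < 1 →
      ‖T xbar - xbar‖ ≤ Y → (∀ x ∈ Metric.closedBall xbar r, ∀ y ∈ Metric.closedBall xbar r,
        ‖T x - T y‖ ≤ Z * ‖x - y‖) → Y + Z * r ≤ r →
          ∃ x ∈ Metric.closedBall xbar r, T x = x

/-- D2c · the certificate piece of the CAP split, in the only shape that types today: SOME Banach space,
SOME contraction ball, and a transfer of its fixed points to the crux. The ∃ over `(E, T, xbar)` is where the
whole content hides (a non-degenerate numerical G-equivariant backward-DSS candidate + validated bounds):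
D2a ∧ D2c ⊢ crux is modus ponens, but D2c has no plan and no candidate — a costume of the crux. -/
def CertificateShape : Prop :=
  ∃ (E : Type) (_ : NormedAddCommGroup E) (_ : NormedSpace ℝ E) (_ : CompleteSpace E)
    (T : E → E) (xbar : E) (r Y Z : ℝ), 0 ≤ r ∧ 0 ≤ Z ∧ Z < 1 ∧
      ‖T xbar - xbar‖ ≤ Y ∧ (∀ x ∈ Metric.closedBall xbar r, ∀ y ∈ Metric.closedBall xbar r,
        ‖T x - T y‖ ≤ Z * ‖x - y‖) ∧ Y + Z * r ≤ r ∧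
      ((∃ x ∈ Metric.closedBall xbar r, T x = x) → QuantisedSymmetry.PolyhedralDssProfileExists)

/-- The CAP split assembles trivially (this is the `trivial_seam` flag of the redirect rule). -/
theorem crux_of_CAP (h1 : RadiiPolynomialNK) (h2 : CertificateShape) :
    QuantisedSymmetry.PolyhedralDssProfileExists := by
  obtain ⟨E, i1, i2, i3, T, xbar, r, Y, Z, hr, hZ0, hZ1, hY, hL, hsum, htr⟩ := h2
  exact htr (h1 E T xbar r Y Z hr hZ0 hZ1 hY hL hsum)

/-- S⁺ · strengthened witness: the crux with an explicit period window `c₀ ≤ c` and Type-I constant floor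
`ε₀ ≤ C₀` exposed as data. For any fixed thresholds below the Chae–Wolf window / GKT ε-regularity floor
this is EQUIVALENT to the crux by the landed stubs `stub_periodWindow` (N1) and `stub_noSmallConstant` (N2):
rigidity already forced, no induction/compactness handle gained. -/
def StrengthenedWitness (c₀ ε₀ : ℝ) : Prop :=
  ∃ G : Subgroup (EuclideanSpace ℝ (Fin 3) ≃ₗᵢ[ℝ] EuclideanSpace ℝ (Fin 3)), Finite G ∧
    (∀ g ∈ G, LinearMap.det (g.toLinearEquiv : EuclideanSpace ℝ (Fin 3) →ₗ[ℝ] EuclideanSpace ℝ (Fin 3)) = 1) ∧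
    (∀ V : Submodule ℝ (EuclideanSpace ℝ (Fin 3)), (∀ g ∈ G, ∀ v ∈ V, g v ∈ V) → V = ⊥ ∨ V = ⊤) ∧
    ∃ c : ℝ, c₀ ≤ c ∧ 1 < c ∧ ∃ u : ℝ → EuclideanSpace ℝ (Fin 3) → EuclideanSpace ℝ (Fin 3),
      IsAncientMildSolution 1 u ∧ (∀ t < 0, AEStronglyMeasurable (u t) volume) ∧
      IsDiscretelySelfSimilar c u ∧ (∃ C₀ : ℝ, ε₀ ≤ C₀ ∧ HasTypeIDecay C₀ u) ∧
      (∀ g ∈ G, ∀ t x, u t (g x) = g (u t x)) ∧ ¬ (∀ t < 0, u t =ᵐ[volume] 0)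

/-- S⁺ ⇒ crux (forget the thresholds). -/
theorem crux_of_strengthened {c₀ ε₀ : ℝ} (h : StrengthenedWitness c₀ ε₀) :
    QuantisedSymmetry.PolyhedralDssProfileExists := by
  obtain ⟨G, hfin, hdet, hirr, c, -, hc, u, hanc, hmeas, hdss, ⟨C₀, -, hdec⟩, heqv, hnt⟩ := h
  exact ⟨G, hfin, hdet, hirr, c, hc, u, hanc, hmeas, hdss, ⟨C₀, hdec⟩, heqv, hnt⟩

end Summit.NavierStokesRegularity.NavierStokesRegularity.Cruxes.PolyhedralDssProfileExists.StrategistS18g4
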